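import Summits.ResolutionOfSingularities.ResolutionOfSingularities.Theorems.WeightedInvariantWeightedThesisHypersurfaceDatum
import Summits.ResolutionOfSingularities.ResolutionOfSingularities.Theorems.WeightedInvariantDatumToEmbeddedRegular
import Literature.AlgebraicGeometry.Resolution.CobordantBlowupGlobal
import Mathlib.AlgebraicGeometry.Morphisms.Smooth
import HarnessLib

/-!
# Hypersurface centre strategies — the datum interface cut down to what the tower consumes

Route `ResolutionOfSingularities/WeightedInvariant`, crux `Theses.WeightedInvariant.WeightedThesis`
(stmt-ResolutionOfSingularities-0569: resolution of every reduced separated scheme of finite type over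
every perfect field of characteristic `p`), line `datum-glued-split`, lead c8, RESHAPE 8 — the STRATEGY
door (objects of the line; the proofs are in `Theorems/WeightedInvariantWeightedThesisHypersurfaceStrategyTower.lean`).

RESHAPE 7 (lead c7, `Theorems/…HypersurfaceDatum.lean`, `…HypersurfaceTower*.lean`) showed that the
route's composition consumes a weighted resolution datum only on integral HYPERSURFACE pairs and re-ran
Włodarczyk's cobordant tower for the interface `HypersurfaceResolutionDatum p` (13 fields: one well-order
`Γ` for all dimensions, a total invariant `inv`, the centre, and the axioms `(usc)`, `(i)` for `inv` and
for the centre, base change, `(ii)`, `(iii)`, `(iv)`). Reading that tower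
(`HypersurfaceTower.hasResolution_quotient_of_gradedAtlas`) shows that the induction uses the datum ONLY
through:

* the centre of a SINGULAR integral hypersurface pair is a regular weighted centre (`(iii)`, first half);
* the generic point of the hypersurface is off the centre (from `(ii)` + `(iii)`);
* functoriality of the centre for smooth surjective `k`-morphisms (homogeneity on torus charts);
* TERMINATION of the tower of global cobordant blow-ups `(Y, X) ↦ (B₊, σˢ(X)|_{B₊})` — the only place
  where `Γ`, `inv`, `(usc)`, `(i)` for `inv` and the drop `(iv)` enter.

This file posits the correspondingly weaker interface:

* `HypersurfacePair k` — a hypersurface pair over `k` (`f : Y → Spec k` smooth separated quasi-compact,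
  `X` a locally principal ideal sheaf on `Y` with integral closed subscheme);
* `HypersurfacePair.Step c` — the tower-step relation of a centre rule `c`: `Step c P' P` iff `V(X(P))`
  is not regular and `P'` is the global cobordant blow-up `B₊ = R'.plus` of a Rees filtration `R'`
  with the pieces of `c P` (Literature `ReesFiltration.plus`, `πPlus`, `strictTransformPlus`), with the
  strict transform — the successor the tower actually visits (`Step.intro`);
* `HypersurfaceCentreStrategy p` — a centre rule with the four properties above, termination stated as
  `WellFounded (HypersurfacePair.Step centre)` over every perfect field of characteristic `p`;
* `hyp_exists_not_isBot_inv_of_not_isRegular` (registered stub of the line) — axiom `(ii)` of a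
  hypersurface datum contraposed: a singular hypersurface pair has a point of non-minimal invariant (the
  guard under which a datum's `(iii)`/`(iv)` are available; used by `HypersurfaceCentreStrategy` built
  from a datum in the Tower file).

What the weakening buys the constructor (census `Cruxes/WeightedConstruction/STRATEGY-CENSUS.md` §6
(γ)): no single well-order across all dimensions (which excludes the `∞`-lex profile invariants of
ATW/AQS a priori), no upper semicontinuity, no base change, no pointwise drop — only that ITS OWN tower
stops. Every hypersurface resolution datum, and a fortiori every weighted resolution datum (stmt-0571),
gives a strategy (`HypersurfaceStrategyTower.nonempty_strategy_of_hypersurfaceDatum`).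
-/

noncomputable section

open CategoryTheory AlgebraicGeometry TopologicalSpace
open Literature.AlgebraicGeometry.Resolution

set_option linter.dupNamespace false -- mandated namespace of this single-conjunct summit

namespace Summit.ResolutionOfSingularities.ResolutionOfSingularities.Theorems

/-! ## Hypersurface pairs and the tower-step relation -/

/-- A **hypersurface pair** over the field `k`: a smooth separated quasi-compact `f : Y → Spec k` and a
locally principal ideal sheaf `X` on `Y` whose closed subscheme `V(X)` is integral — the only pairs
Włodarczyk's cobordant tower visits when started on an integral hypersurface
(`Theorems/…HypersurfacePreserved.lean`; Włodarczyk 2022, §3.3). EVIDENCE, not a claim. [folklore] -/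
structure HypersurfacePair (k : Type) [Field k] : Type 1 where
  /-- the ambient scheme -/
  Y : Scheme.{0}
  /-- its structure morphism -/
  f : Y ⟶ Spec (.of k)
  /-- `Y` is smooth over `k` … -/
  [smooth : Smooth f]
  /-- … separated … -/
  [isSeparated : IsSeparated f]
  /-- … and quasi-compact -/
  [quasiCompact : QuasiCompact f]
  /-- the ideal sheaf of the hypersurface -/
  X : Y.IdealSheafData
  /-- `X` is locally principal -/
  isLocallyPrincipal : IsLocallyPrincipal X
  /-- `V(X)` is integral -/
  isIntegral : IsIntegral X.subscheme

namespace HypersurfacePair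

variable {k : Type} [Field k]

/-- The ambient of a hypersurface pair is smooth over `k` (structure field as an instance). [folklore] -/
instance smooth_f (P : HypersurfacePair k) : Smooth P.f := P.smooth

/-- The ambient of a hypersurface pair is separated over `k` (structure field as an instance). [folklore] -/
instance isSeparated_f (P : HypersurfacePair k) : IsSeparated P.f := P.isSeparated

/-- The ambient of a hypersurface pair is quasi-compact over `k` (structure field as an instance). [folklore] -/
instance quasiCompact_f (P : HypersurfacePair k) : QuasiCompact P.f := P.quasiCompact

/-- The ambient scheme of a hypersurface pair is non-empty (the hypersurface is integral). [folklore] -/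
instance nonempty_Y (P : HypersurfacePair k) : Nonempty P.Y :=
  haveI := P.isIntegral
  ⟨P.X.subschemeι (Classical.arbitrary P.X.subscheme)⟩

/-- **The tower-step relation of a centre rule `c`.** `Step c P' P` says: the hypersurface `V(X)` of
`P = (Y, X)` is NOT regular, and `P'` is the successor pair the cobordant tower visits — the global
cobordant blow-up `B₊ = R'.plus ⟶ Y ⟶ Spec k` of a Rees filtration `R'` on `Y` whose pieces are those
of the centre `c P` (Włodarczyk 2022, Def. 2.3.5 / 5.1.1), with the strict transform `σˢ(X)|_{B₊}`
(§3.3); the facts that `B₊ → Spec k` is smooth separated quasi-compact and that the successor is again a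
hypersurface pair are recorded as data of the step (the tower proves them:
`GlobalCobordantPlus.smooth_πPlus_comp_of_isRegularWeightedCentre`,
`HypersurfacePreserved.isLocallyPrincipal_strictTransformPlus`,
`StrictTransform.isIntegral_strictTransformPlus_of_not_mem_support`). A predicate of the line,
not a cited statement. [folklore] -/
def Step (c : ∀ ⦃Y : Scheme.{0}⦄, (Y ⟶ Spec (.of k)) → Y.IdealSheafData → ReesAlgebraData Y)
    (P' P : HypersurfacePair k) : Prop :=
  ¬ Scheme.IsRegular P.X.subscheme ∧
    ∃ (R' : ReesFiltration P.Y) (_ : R'.ideal = (c P.f P.X).piece)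
      (hs : Smooth (R'.πPlus ≫ P.f)) (hsep : IsSeparated (R'.πPlus ≫ P.f))
      (hqc : QuasiCompact (R'.πPlus ≫ P.f))
      (hlp : IsLocallyPrincipal (R'.strictTransformPlus P.X))
      (hint : IsIntegral (R'.strictTransformPlus P.X).subscheme),
      P' = @HypersurfacePair.mk k _ R'.plus (R'.πPlus ≫ P.f) hs hsep hqc (R'.strictTransformPlus P.X)
        hlp hint

/-- **Introduction rule of the tower step**: the successor of a singular hypersurface pair along the
global cobordant blow-up of (a Rees filtration with the pieces of) its centre is a step below it.
[folklore] -/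
theorem Step.intro {c : ∀ ⦃Y : Scheme.{0}⦄, (Y ⟶ Spec (.of k)) → Y.IdealSheafData → ReesAlgebraData Y}
    (P : HypersurfacePair k) (hsing : ¬ Scheme.IsRegular P.X.subscheme)
    (R' : ReesFiltration P.Y) (hR' : R'.ideal = (c P.f P.X).piece)
    (hs : Smooth (R'.πPlus ≫ P.f)) (hsep : IsSeparated (R'.πPlus ≫ P.f))
    (hqc : QuasiCompact (R'.πPlus ≫ P.f))
    (hlp : IsLocallyPrincipal (R'.strictTransformPlus P.X))
    (hint : IsIntegral (R'.strictTransformPlus P.X).subscheme) :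
    Step c (@HypersurfacePair.mk k _ R'.plus (R'.πPlus ≫ P.f) hs hsep hqc
      (R'.strictTransformPlus P.X) hlp hint) P :=
  ⟨hsing, R', hR', hs, hsep, hqc, hlp, hint, rfl⟩

end HypersurfacePair

/-! ## Hypersurface centre strategies -/

/-- **Hypersurface centre strategy in characteristic `p`** (object posited by line `datum-glued-split`
of crux `WeightedThesis`, RESHAPE 8 — the strategy door): for every field `k`, every `k`-scheme
`f : Y → Spec k` and every ideal sheaf `X` on `Y` a Rees algebra `centre f X` on `Y` (total), such that,
for `k` perfect of characteristic `p`, `f` smooth separated quasi-compact and `X` a locally principal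
ideal sheaf with integral, NON-REGULAR closed subscheme: `(iii)` the centre is a regular weighted centre,
`(ii')` the generic point of the hypersurface is off its support, `(i)` the centre is functorial for
smooth surjective `k`-morphisms, and `(T)` over every perfect field of characteristic `p` the tower-step
relation `HypersurfacePair.Step centre` (global cobordant blow-up of the centre, strict transform) is
well-founded — every cobordant tower stops. This is exactly what the hypersurface tower of the route
consumes (`Theorems/…HypersurfaceStrategyTower.lean`); every hypersurface resolution datum is one
(`HypersurfaceStrategyTower.nonempty_strategy_of_hypersurfaceDatum`). Shape: the centre functor of
Abramovich–Temkin–Włodarczyk 2024 Thm. 1.1.1 / Włodarczyk arXiv:2203.03090 Thm. 1.1.4, restricted to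
hypersurfaces, with the invariant demoted from the interface to a proof device. EVIDENCE, not a claim. -/
structure HypersurfaceCentreStrategy (p : ℕ) : Type 1 where
  /-- the weighted centre of `(Y, X)`, as a Rees algebra on `Y` (total) -/
  centre : ∀ ⦃k : Type⦄ [Field k] ⦃Y : Scheme.{0}⦄, (Y ⟶ Spec (.of k)) → Y.IdealSheafData →
    ReesAlgebraData Y
  /-- `(iii)` [singular hypersurface pairs] the centre is a regular weighted centre -/
  isRegularWeightedCentre_centre : ∀ ⦃k : Type⦄ [Field k] [CharP k p] [PerfectField k]
    ⦃Y : Scheme.{0}⦄ (f : Y ⟶ Spec (.of k)) [Smooth f] [IsSeparated f] [QuasiCompact f]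
    (X : Y.IdealSheafData), IsLocallyPrincipal X → IsIntegral X.subscheme →
    ¬ Scheme.IsRegular X.subscheme → (centre f X).IsRegularWeightedCentre
  /-- `(ii')` [singular hypersurface pairs, presented by a closed immersion `i`] the generic point of
  the hypersurface is off the centre -/
  genericPoint_not_mem_support_centre : ∀ ⦃k : Type⦄ [Field k] [CharP k p] [PerfectField k]
    ⦃Y X : Scheme.{0}⦄ (f : Y ⟶ Spec (.of k)) [Smooth f] [IsSeparated f] [QuasiCompact f]
    (i : X ⟶ Y) [IsClosedImmersion i] [IsIntegral X], IsLocallyPrincipal i.ker →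
    ¬ Scheme.IsRegular X → i (genericPoint X) ∉ (centre f i.ker).support
  /-- `(i)` for the centre [singular hypersurface pairs]: smooth SURJECTIVE `k`-morphisms -/
  centre_comap : ∀ ⦃k : Type⦄ [Field k] [CharP k p] [PerfectField k] ⦃Y Y₁ : Scheme.{0}⦄
    (f : Y ⟶ Spec (.of k)) [Smooth f] [IsSeparated f] [QuasiCompact f]
    (f₁ : Y₁ ⟶ Spec (.of k)) [Smooth f₁] [IsSeparated f₁] [QuasiCompact f₁]
    (g : Y₁ ⟶ Y) [Smooth g] [Surjective g], g ≫ f = f₁ →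
    ∀ (X : Y.IdealSheafData), IsLocallyPrincipal X → IsIntegral X.subscheme →
    ¬ Scheme.IsRegular X.subscheme →
    ∀ n : ℕ, (centre f₁ (X.comap g)).piece n = ((centre f X).piece n).comap g
  /-- `(T)` over every perfect field of characteristic `p`, every cobordant tower stops -/
  wellFounded_step : ∀ ⦃k : Type⦄ [Field k] [CharP k p] [PerfectField k],
    WellFounded (HypersurfacePair.Step (k := k) fun ⦃Y : Scheme.{0}⦄ (f : Y ⟶ Spec (.of k)) X =>
      centre f X)

/-! ## Axiom `(ii)` of a hypersurface datum, contraposed (the guard from non-regularity) -/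

/-- **A singular hypersurface pair has a point of non-minimal invariant** (registered stub of line
`datum-glued-split`, RESHAPE 8): for a hypersurface resolution datum `D`, a smooth separated
quasi-compact `f : Y → Spec k` over a perfect field of characteristic `p` and a locally principal ideal
sheaf `X` with integral closed subscheme `V(X)` that is NOT regular, `D.inv f X` is not everywhere
minimal — axiom `(ii)` (`inv` minimal iff off `X` or at a regular point of `V(X)`) contraposed. This is
the guard under which the datum's axioms `(iii)`/`(iv)` speak. [folklore] -/
theorem hyp_exists_not_isBot_inv_of_not_isRegular : ∀ {p : ℕ} (D : Summit.ResolutionOfSingularities.ResolutionOfSingularities.Theorems.HypersurfaceResolutionDatum p) {k : Type} [Field k] [CharP k p] [PerfectField k] {Y : AlgebraicGeometry.Scheme.{0}} (f : Y ⟶ AlgebraicGeometry.Spec (.of k)) [AlgebraicGeometry.Smooth f] [AlgebraicGeometry.IsSeparated f] [AlgebraicGeometry.QuasiCompact f] (X : Y.IdealSheafData), Literature.AlgebraicGeometry.Resolution.IsLocallyPrincipal X → AlgebraicGeometry.IsIntegral X.subscheme → ¬ Literature.AlgebraicGeometry.Resolution.Scheme.IsRegular X.subscheme → ∃ y : Y,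 ¬ IsBot (D.inv f X y) := by
  intro p D k _ _ _ Y f _ _ _ X hX hXi hsing
  by_contra h
  push Not at h
  exact hsing fun x => (D.isBot_inv_iff f X hX hXi (X.subschemeι x)).mp (h _) x rfl

end Summit.ResolutionOfSingularities.ResolutionOfSingularities.Theorems

end
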